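import Literature.Combinatorics.Designs.TMatrixRows
import Literature.Combinatorics.Designs.SequenceSumSquares

/-!
# Hadamard 668 census — no SYMMETRIC circulant T-matrices of order 167 (kernel; any order `≡ 3 (mod 4)`)

Framing: lottery ticket; floor = certified bounds/negative ranges.

Cell pub-namedobj (venture DiscreteObjects), target (H).  Circulant T-matrices of order `167` would give `H(668)`
(`TurynTypeFamily668.hadamard668_of_tMatrixRows167`).  The smallest structured sub-family one would search — in analogy
with Williamson matrices inside the Goethals–Seidel family — is the SYMMETRIC one: first rows with `t_k(-x) = t_k(x)`
(equivalently, supports and signs invariant under the multiplier `-1`, the cyclotomic structure of index `e = 83` at the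
prime `167`; the only other proper multiplier structure, index `e = 2` = QR/NQR classes, forces row sums `≡ 0 (mod 83)`
and is dead by the same grammar).  This sub-family is EMPTY, by an elementary parity argument formalised here for every
order `n ≡ 3 (mod 4)`:
* `tmatrixRows_sum_sq` — the periodic grammar `Σ_k (Σ_x t_k(x))² = n` (Seberry–Yamada 2020 Lemma 1.19 with `P_X = 0`);
* `sum_symm_castTwo` — for a symmetric integer function on `ZMod n`, `n` odd, `Σ_x f(x) ≡ f(0) (mod 2)` (the non-zero
  residues pair off as `{x, -x}`);
* so the four row sums satisfy `S_k ≡ t_k(0) (mod 2)` with exactly one `t_k(0) = ±1`: `Σ S_k² ≡ Σ t_k(0)² = 1 (mod 4)`,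
  contradicting `n ≡ 3 (mod 4)`: **`no_symmetric_tMatrixRows`**, and at the target **`no_symmetric_tMatrixRows_167`**.
A certified-empty structured sub-family at the target order (ours; elementary; PROVISIONAL as to novelty — the parity
obstruction `v ≡ 3 (mod 4)` for symmetric T-matrices is surely folklore).  General (unsymmetric) T-matrices /
T-sequences of length `167` remain OPEN; no order excluded; H(668) untouched; HITS 0.  No `sorry`.
-/

open Finset BigOperators

namespace Summit.Ventures.DiscreteObjects.Hadamard

open Literature.Combinatorics.Designs.LegendrePairs (PAF)
open Literature.Combinatorics.Designs.TSequences
open Literature.Combinatorics.Designs.TMatrices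
open Literature.Combinatorics.Designs.SequenceSums

section General

variable {n : ℕ} [NeZero n]

/-- in each position of T-matrix rows the squares of the four entries add up to `1`. -/
lemma tmatrixRows_sum_sq_entry {t : Fin 4 → ZMod n → ℤ} (ht : IsTMatrixRows n t) (x : ZMod n) :
    ∑ k, t k x * t k x = 1 := by
  obtain ⟨k, hk, h0⟩ := ht.1 x
  rw [Finset.sum_eq_single k]
  · rcases hk with h | h <;> simp [h]
  · intro k' _ hk'
    simp [h0 k' hk']
  · intro h
    exact absurd (mem_univ k) h

/-- **periodic grammar**: for first rows of circulant T-matrices of order `n`, `Σ_k (Σ_x t_k(x))² = n`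
(SY 2020 Lemma 1.19 in the case `P_X = 0`). -/
theorem tmatrixRows_sum_sq {t : Fin 4 → ZMod n → ℤ} (ht : IsTMatrixRows n t) :
    ∑ k, (∑ x, t k x) ^ 2 = n := by
  simp_rw [sq_sum_eq_sum_paf]
  rw [Finset.sum_comm]
  rw [← Finset.add_sum_erase _ _ (mem_univ (0 : ZMod n))]
  have hz : ∑ s ∈ (univ : Finset (ZMod n)).erase 0, ∑ k, PAF (t k) s = 0 :=
    Finset.sum_eq_zero fun s hs => ht.2 s (mem_erase.mp hs).1
  rw [hz, add_zero]
  unfold PAF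
  simp_rw [add_zero]
  rw [Finset.sum_comm]
  simp_rw [tmatrixRows_sum_sq_entry ht]
  simp [ZMod.card]

/-- in `ZMod n` with `n` odd, `-a = a` forces `a = 0`. -/
lemma eq_zero_of_neg_eq_self (hn : n % 2 = 1) {a : ZMod n} (h : -a = a) : a = 0 := by
  have h2 : a + a = 0 := by
    calc a + a = a + -a := by rw [h]
      _ = 0 := add_neg_cancel a
  have hv : (a + a).val = 0 := by rw [h2, ZMod.val_zero]
  rw [ZMod.val_add] at hv
  have hlt : a.val < n := ZMod.val_lt a
  -- (a.val + a.val) % n = 0 with a.val + a.val < 2n forces a.val + a.val ∈ {0, n}; n odd excludes n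
  have hval : a.val = 0 := by
    obtain ⟨q, hq⟩ := Nat.dvd_of_mod_eq_zero hv
    have hq2 : q < 2 := by
      rcases Nat.lt_or_ge q 2 with hlt2 | hge2
      · exact hlt2
      · have : n * 2 ≤ n * q := Nat.mul_le_mul_left n hge2
        omega
    interval_cases q <;> omega
  exact (ZMod.val_eq_zero a).mp hval

/-- **parity of a symmetric sum**: if `f(-x) = f(x)` on `ZMod n` with `n` odd, then `Σ_x f(x) ≡ f(0) (mod 2)`
(the non-zero residues pair off as `{x, -x}`, `x ≠ -x`). -/
theorem sum_symm_castTwo (hn : n % 2 = 1) (f : ZMod n → ℤ) (hf : ∀ x, f (-x) = f x) :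
    ((∑ x, f x : ℤ) : ZMod 2) = (f 0 : ZMod 2) := by
  rw [← Finset.add_sum_erase _ _ (mem_univ (0 : ZMod n))]
  push_cast
  have hz : ∑ x ∈ (univ : Finset (ZMod n)).erase 0, ((f x : ℤ) : ZMod 2) = 0 := by
    refine Finset.sum_involution (fun x _ => -x) ?_ ?_ ?_ ?_
    · intro a _
      rw [hf a, ← two_mul]
      have : (2 : ZMod 2) = 0 := by decide
      rw [this, zero_mul]
    · intro a ha _
      have ha0 : a ≠ 0 := (mem_erase.mp ha).1
      exact fun h => ha0 (eq_zero_of_neg_eq_self hn h)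
    · intro a ha
      exact mem_erase.mpr ⟨neg_ne_zero.mpr (mem_erase.mp ha).1, mem_univ _⟩
    · intro a _
      exact neg_neg a
  rw [hz, add_zero]

/-- the square of an integer congruent to `e` mod `2` is congruent to `e²` mod `4`: `(e + 2m)² = e² + 4(m e + m²)`. -/
lemma sq_of_castTwo_eq {S e : ℤ} (h : (S : ZMod 2) = (e : ZMod 2)) : ∃ M : ℤ, S ^ 2 = e ^ 2 + 4 * M := by
  have hd : (2 : ℤ) ∣ e - S := (ZMod.intCast_eq_intCast_iff_dvd_sub S e 2).mp h
  obtain ⟨m, hm⟩ := hd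
  refine ⟨m * m - m * e, ?_⟩
  have hS : S = e - 2 * m := by linarith
  rw [hS]
  ring

/-- **No symmetric circulant T-matrices of order `n ≡ 3 (mod 4)`.**  If `t` are first rows of circulant T-matrices of
order `n` with every row symmetric (`t_k(-x) = t_k(x)`), then `n ≢ 3 (mod 4)`. -/
theorem no_symmetric_tMatrixRows (hn : n % 4 = 3) {t : Fin 4 → ZMod n → ℤ} (ht : IsTMatrixRows n t)
    (hsym : ∀ k x, t k (-x) = t k x) : False := by
  have hodd : n % 2 = 1 := by omega
  have hgram := tmatrixRows_sum_sq ht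
  have hentry := tmatrixRows_sum_sq_entry ht 0
  rw [Fin.sum_univ_four] at hgram hentry
  -- parities of the four row sums
  obtain ⟨M0, h0⟩ := sq_of_castTwo_eq (sum_symm_castTwo hodd (t 0) (hsym 0))
  obtain ⟨M1, h1⟩ := sq_of_castTwo_eq (sum_symm_castTwo hodd (t 1) (hsym 1))
  obtain ⟨M2, h2⟩ := sq_of_castTwo_eq (sum_symm_castTwo hodd (t 2) (hsym 2))
  obtain ⟨M3, h3⟩ := sq_of_castTwo_eq (sum_symm_castTwo hodd (t 3) (hsym 3))
  rw [h0, h1, h2, h3] at hgram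
  -- Σ t_k(0)² = 1, so n = 1 + 4 M, contradicting n ≡ 3 (mod 4)
  have e0 : t 0 0 ^ 2 + t 1 0 ^ 2 + t 2 0 ^ 2 + t 3 0 ^ 2 = 1 := by
    simpa [sq] using hentry
  have key : (n : ℤ) = 1 + 4 * (M0 + M1 + M2 + M3) := by linarith
  omega

end General

/-- **at the target order: no symmetric circulant T-matrices of order 167** (`167 ≡ 3 (mod 4)`) — the Williamson-like
(multiplier `-1`, cyclotomic index `83`) sub-family of the T-matrix route to `H(668)` is EMPTY. -/
theorem no_symmetric_tMatrixRows_167 :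
    ¬ ∃ t : Fin 4 → ZMod 167 → ℤ, IsTMatrixRows 167 t ∧ ∀ k x, t k (-x) = t k x :=
  fun ⟨_, ht, hsym⟩ => no_symmetric_tMatrixRows (by norm_num) ht hsym

/-- the same for T-sequences of length `167` read periodically: no T-sequences of length `167` whose periodisations are
symmetric (`t_k((−x) mod 167) = t_k(x mod 167)`). -/
theorem no_symmetric_tSeq_167 :
    ¬ ∃ t : Fin 4 → ℕ → ℤ, IsTSeq 167 t ∧ ∀ k (x : ZMod 167), periodize 167 (t k) (-x) = periodize 167 (t k) x :=
  fun ⟨t, ht, hsym⟩ => no_symmetric_tMatrixRows (n := 167) (by norm_num) (tseq_tmatrixRows ht) hsym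

end Summit.Ventures.DiscreteObjects.Hadamard
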